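import Mathlib.Data.Nat.Factorization.Basic
import Mathlib.Data.Nat.ModEq
import Mathlib.Algebra.BigOperators.Group.Finset.Basic
import Mathlib.Algebra.Ring.GeomSum
import Mathlib.Tactic.Ring
import Mathlib.Tactic.Linarith
import HarnessLib

/-!
# Powers of principal units `1 + p^j a` modulo `p^M` ("lifting the exponent")

Elementary arithmetic of the group `1 + p^j ℤ_p ⊆ ℤ_pˣ`, in the finite form needed by Tate's
normalised traces on the cyclotomic tower (`TateNormalizedTrace`): an element `γ` of the Galois
group acts on the `p^M`-th roots of unity by `ζ ↦ ζ^u`, `u = 1 + p^j a` with `p ∤ a`, and the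
computation of the averages `p^{-(M-j)} Σ_{k < p^{M-j}} γ^k` rests on the structure of the cyclic
group generated by `u` modulo `p^M`. Everything is stated in `ℕ`:

* `exists_one_add_pow` : `(1 + y)^d = 1 + d y + c y²` in any commutative semiring;
* `exists_pow_prime_pow_eq` (A) : `j ≥ 1` ⇒ `(1 + p^j t)^{p^e} = 1 + p^{j+e} t'`;
* `exists_pow_prime_pow_eq_of_not_dvd` (B) : `j ≥ 2`, `p ∤ a` ⇒ `(1 + p^j a)^{p^e} = 1 + p^{j+e} b`
  with `p ∤ b` — the order of `1 + p^j a` modulo `p^M` is exactly `p^{M-j}`;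
* `prime_pow_dvd_of_pow_modEq_one` (C) : `j ≥ 2`, `p ∤ a`, `(1 + p^j a)^d ≡ 1 (mod p^M)`, `d ≠ 0`
  ⇒ `p^{M-j} ∣ d`;
* `sum_pow_mod_eq_sum` (reindexing) : for `2 ≤ j ≤ M`, `p ∤ a`, `N = p^{M-j}` and any `f`,
  `Σ_{k<N} f((1 + p^j a)^k mod p^M) = Σ_{t<N} f(1 + p^j t)` — the residues of the powers `u^k`,
  `k < N`, are exactly the `1 + p^j t`, `t < N`.

(For `p` odd, (B)–(C) also hold with `j = 1`; the uniform hypothesis `j ≥ 2` is what the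
application uses.) Serre, *Local Fields* XIV §4 / *A Course in Arithmetic* II §3.2 (structure of
`1 + pℤ_p`); Washington, *Cyclotomic Fields*, proof of Thm. 4.1.

## References

* J.-P. Serre, *A Course in Arithmetic*, Ch. II §3.2 (the groups `U_n = 1 + p^n ℤ_p`,
  `(1 + p^n x)^p ≡ 1 + p^{n+1} x`). [Serre1973]
* J.-P. Serre, *Local Fields*, Ch. XIV §4. [SerreLocalFields1979]
-/

namespace Literature.NumberTheory.PAdicHodge

namespace PrincipalUnitPowers

open Finset

/-- **Binomial expansion to second order**: `(1 + y)^d = 1 + d y + c y²` for some `c`. [folklore] -/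
theorem exists_one_add_pow {R : Type*} [CommSemiring R] (y : R) (d : ℕ) :
    ∃ c : R, (1 + y) ^ d = 1 + d * y + c * y ^ 2 := by
  induction d with
  | zero => exact ⟨0, by simp⟩
  | succ d ih =>
    obtain ⟨c, hc⟩ := ih
    refine ⟨d + c + c * y, ?_⟩
    rw [pow_succ, hc]
    push_cast
    ring

variable {p : ℕ}

/-- (A), one step: `(1 + p^j t)^p = 1 + p^{j+1} t'` for `j ≥ 1`.
[cite: Serre1973, Ch. II §3.2] -/
theorem exists_pow_prime_eq {j : ℕ} (hj : 1 ≤ j) (t : ℕ) :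
    ∃ t' : ℕ, (1 + p ^ j * t) ^ p = 1 + p ^ (j + 1) * t' := by
  obtain ⟨c, hc⟩ := exists_one_add_pow (p ^ j * t) p
  rw [Nat.cast_id] at hc
  refine ⟨t + c * p ^ (j - 1) * t ^ 2, ?_⟩
  rw [hc]
  obtain ⟨i, rfl⟩ := Nat.exists_eq_add_of_le' hj
  simp only [Nat.add_sub_cancel]
  ring

/-- **(A)**: `(1 + p^j t)^{p^e} = 1 + p^{j+e} t'` for `j ≥ 1` — a principal unit of level `j` has
order dividing `p^{M-j}` modulo `p^M`. [cite: Serre1973, Ch. II §3.2] -/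
theorem exists_pow_prime_pow_eq {j : ℕ} (hj : 1 ≤ j) (t : ℕ) (e : ℕ) :
    ∃ t' : ℕ, (1 + p ^ j * t) ^ p ^ e = 1 + p ^ (j + e) * t' := by
  induction e with
  | zero => exact ⟨t, by simp⟩
  | succ e ih =>
    obtain ⟨t₁, h₁⟩ := ih
    obtain ⟨t₂, h₂⟩ := exists_pow_prime_eq (show 1 ≤ j + e by omega) t₁
    refine ⟨t₂, ?_⟩
    rw [pow_succ, pow_mul, h₁, h₂, show j + (e + 1) = j + e + 1 by omega]

/-- (B), one step: `(1 + p^j a)^p = 1 + p^{j+1} b` with `b ≡ a (mod p)`, for `j ≥ 2`.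
[cite: Serre1973, Ch. II §3.2] -/
theorem exists_pow_prime_eq_of_two_le {j : ℕ} (hj : 2 ≤ j) (a : ℕ) :
    ∃ b : ℕ, (1 + p ^ j * a) ^ p = 1 + p ^ (j + 1) * b ∧ b ≡ a [MOD p] := by
  obtain ⟨c, hc⟩ := exists_one_add_pow (p ^ j * a) p
  rw [Nat.cast_id] at hc
  refine ⟨a + p * (c * p ^ (j - 2) * a ^ 2), ?_, ?_⟩
  · rw [hc]
    obtain ⟨i, rfl⟩ := Nat.exists_eq_add_of_le' hj
    simp only [Nat.add_sub_cancel]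
    ring
  · exact ((Nat.modEq_iff_dvd' (Nat.le_add_right a _)).mpr ⟨c * p ^ (j - 2) * a ^ 2, by rw [Nat.add_sub_cancel_left]⟩).symm

/-- **(B)**: `(1 + p^j a)^{p^e} = 1 + p^{j+e} b` with `p ∤ b`, for `j ≥ 2` and `p ∤ a` — the order
of `1 + p^j a` modulo `p^M` is exactly `p^{M-j}`. [cite: Serre1973, Ch. II §3.2] -/
theorem exists_pow_prime_pow_eq_of_not_dvd {j : ℕ} (hj : 2 ≤ j) {a : ℕ} (ha : ¬p ∣ a) (e : ℕ) :
    ∃ b : ℕ, (1 + p ^ j * a) ^ p ^ e = 1 + p ^ (j + e) * b ∧ ¬p ∣ b := by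
  induction e with
  | zero => exact ⟨a, by simp, ha⟩
  | succ e ih =>
    obtain ⟨b₁, h₁, hb₁⟩ := ih
    obtain ⟨b₂, h₂, hb₂⟩ := exists_pow_prime_eq_of_two_le (show 2 ≤ j + e by omega) b₁
    refine ⟨b₂, ?_, ?_⟩
    · rw [pow_succ, pow_mul, h₁, h₂, show j + (e + 1) = j + e + 1 by omega]
    · intro h
      exact hb₁ ((Nat.ModEq.dvd_iff hb₂ (dvd_refl p)).mp h)

variable (hp : p.Prime)
include hp

/-- (A) in congruence form: `u ≡ 1 (mod p^j)`, `j ≥ 1` ⇒ `u^{p^e} ≡ 1 (mod p^{j+e})`.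
[cite: Serre1973, Ch. II §3.2] -/
theorem pow_prime_pow_modEq_one {j : ℕ} (hj : 1 ≤ j) {u : ℕ} (hu : u ≡ 1 [MOD p ^ j]) (e : ℕ) :
    u ^ p ^ e ≡ 1 [MOD p ^ (j + e)] := by
  -- `u = 1 + p^j t` (note `u ≥ 1` since `u ≡ 1` and `p^j > 1`)
  have hpj : 1 < p ^ j := Nat.one_lt_pow (by omega) hp.one_lt
  have hu1 : 1 ≤ u := by
    rcases Nat.eq_zero_or_pos u with rfl | h
    · exfalso
      have := (Nat.modEq_iff_dvd' (Nat.zero_le 1)).mp hu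
      simp only [Nat.sub_zero, Nat.dvd_one] at this
      omega
    · exact h
  obtain ⟨t, ht⟩ : ∃ t, u = 1 + p ^ j * t := by
    have hdvd := (Nat.modEq_iff_dvd' hu1).mp hu.symm
    obtain ⟨t, ht⟩ := hdvd
    exact ⟨t, by omega⟩
  obtain ⟨t', ht'⟩ := exists_pow_prime_pow_eq hj t e
  rw [ht, ht']
  exact ((Nat.modEq_iff_dvd' (Nat.le_add_right 1 _)).mpr ⟨t', by rw [Nat.add_sub_cancel_left]⟩).symm

/-- **(C)**: if `(1 + p^j a)^d ≡ 1 (mod p^M)` with `j ≥ 2`, `j ≤ M`, `p ∤ a` and `d ≠ 0`, then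
`p^{M-j} ∣ d`. (Write `d = p^e d'`, `p ∤ d'`; by (B), `(1 + p^j a)^{p^e} = 1 + p^{j+e} b`, `p ∤ b`,
and `(1 + p^{j+e} b)^{d'} ≡ 1 + d' b p^{j+e} ≢ 1 (mod p^{j+e+1})`, forcing `j + e + 1 > M`.)
[cite: Serre1973, Ch. II §3.2] -/
theorem prime_pow_dvd_of_pow_modEq_one {j M : ℕ} (hj : 2 ≤ j) (hjM : j ≤ M) {a : ℕ} (ha : ¬p ∣ a)
    {d : ℕ} (hd0 : d ≠ 0) (hd : (1 + p ^ j * a) ^ d ≡ 1 [MOD p ^ M]) : p ^ (M - j) ∣ d := by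
  obtain ⟨e, d', hd', rfl⟩ := Nat.exists_eq_pow_mul_and_not_dvd hd0 p hp.one_lt.ne'
  -- it suffices that `M - j ≤ e`
  suffices hMe : M - j ≤ e from
    dvd_mul_of_dvd_left (pow_dvd_pow p hMe) d'
  by_contra hlt
  push Not at hlt
  -- `w = (1 + p^j a)^{p^e} = 1 + p^{j+e} b`, `p ∤ b`
  obtain ⟨b, hb, hpb⟩ := exists_pow_prime_pow_eq_of_not_dvd hj ha e
  obtain ⟨c, hc⟩ := exists_one_add_pow (p ^ (j + e) * b) d'
  rw [Nat.cast_id] at hc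
  have hw : (1 + p ^ j * a) ^ (p ^ e * d') = 1 + d' * (p ^ (j + e) * b) + c * (p ^ (j + e) * b) ^ 2 := by
    rw [pow_mul, hb, hc]
  -- reduce the congruence modulo `p^{j+e+1} ∣ p^M`
  have hle : j + e + 1 ≤ M := by omega
  have hmod : 1 + d' * (p ^ (j + e) * b) + c * (p ^ (j + e) * b) ^ 2 ≡ 1 [MOD p ^ (j + e + 1)] := by
    rw [← hw]
    exact Nat.ModEq.of_dvd (pow_dvd_pow p hle) hd
  have hdvd : p ^ (j + e + 1) ∣ d' * (p ^ (j + e) * b) + c * (p ^ (j + e) * b) ^ 2 := by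
    have := (Nat.modEq_iff_dvd' (by omega)).mp hmod.symm
    simpa [Nat.add_sub_cancel_left, add_assoc] using this
  -- divide by `p^{j+e}`: `p ∣ d' b + c b² p^{j+e}`
  have hdvd' : p ∣ d' * b + c * b ^ 2 * p ^ (j + e) := by
    have h2 : d' * (p ^ (j + e) * b) + c * (p ^ (j + e) * b) ^ 2 =
        p ^ (j + e) * (d' * b + c * b ^ 2 * p ^ (j + e)) := by ring
    rw [h2, pow_succ] at hdvd
    exact (Nat.mul_dvd_mul_iff_left (pow_pos hp.pos _)).mp hdvd
  have hdvd'' : p ∣ d' * b := by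
    have h3 : p ∣ c * b ^ 2 * p ^ (j + e) :=
      Dvd.dvd.mul_left (dvd_pow_self p (by omega)) _
    exact (Nat.dvd_add_left h3).mp hdvd'
  rcases (Nat.Prime.dvd_mul hp).mp hdvd'' with h | h
  · exact hd' h
  · exact hpb h

/-- The powers `u^k`, `k < p^{M-j}`, of `u = 1 + p^j a` (`j ≥ 2`, `p ∤ a`) are pairwise
incongruent modulo `p^M`. [cite: Serre1973, Ch. II §3.2] -/
theorem pow_mod_injOn {j M : ℕ} (hj : 2 ≤ j) (hjM : j ≤ M) {a : ℕ} (ha : ¬p ∣ a) :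
    Set.InjOn (fun k : ℕ => (1 + p ^ j * a) ^ k % p ^ M) (Finset.range (p ^ (M - j)) : Set ℕ) := by
  -- WLOG `k' ≤ k`; then `u^(k-k') ≡ 1`, so `p^(M-j) ∣ k - k' < p^(M-j)`
  have key : ∀ k k' : ℕ, k < p ^ (M - j) → k' ≤ k →
      (1 + p ^ j * a) ^ k % p ^ M = (1 + p ^ j * a) ^ k' % p ^ M → k = k' := by
    intro k k' hk hk'k h
    by_contra hne
    have hd0 : k - k' ≠ 0 := by omega
    -- `u^(k-k') ≡ 1 (mod p^M)`: cancel the unit `u^k'`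
    have hcong : (1 + p ^ j * a) ^ k ≡ (1 + p ^ j * a) ^ k' [MOD p ^ M] := h
    have hcop : Nat.Coprime ((1 + p ^ j * a) ^ k') (p ^ M) := by
      apply Nat.Coprime.pow
      rw [Nat.coprime_comm, Nat.Prime.coprime_iff_not_dvd hp]
      intro hdvd
      have h1 : p ∣ p ^ j * a := Dvd.dvd.mul_right (dvd_pow_self p (by omega)) a
      have : p ∣ 1 := (Nat.dvd_add_left h1).mp hdvd
      exact hp.one_lt.ne' (Nat.dvd_one.mp this)
    have hsplit : (1 + p ^ j * a) ^ k = (1 + p ^ j * a) ^ k' * (1 + p ^ j * a) ^ (k - k') := by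
      rw [← pow_add]; congr 1; omega
    rw [hsplit] at hcong
    have h1 : (1 + p ^ j * a) ^ k' * (1 + p ^ j * a) ^ (k - k') ≡ (1 + p ^ j * a) ^ k' * 1
        [MOD p ^ M] := by rwa [mul_one]
    have h2 : (1 + p ^ j * a) ^ (k - k') ≡ 1 [MOD p ^ M] :=
      Nat.ModEq.cancel_left_of_coprime hcop.symm h1
    have hdvd := prime_pow_dvd_of_pow_modEq_one hp hj hjM ha hd0 h2
    have : p ^ (M - j) ≤ k - k' := Nat.le_of_dvd (by omega) hdvd
    omega
  intro k hk k' hk' h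
  simp only [Finset.coe_range, Set.mem_Iio] at hk hk'
  rcases le_total k' k with hle | hle
  · exact key k k' hk hle h
  · exact (key k' k hk' hle h.symm).symm

/-- **Reindexing of the powers of a principal unit**: for `u = 1 + p^j a` (`2 ≤ j ≤ M`, `p ∤ a`)
and `N = p^{M-j}`, the residues `u^k mod p^M`, `k < N`, are exactly the numbers `1 + p^j t`,
`t < N`; hence `Σ_{k<N} f(u^k mod p^M) = Σ_{t<N} f(1 + p^j t)` for every `f`.
[cite: Serre1973, Ch. II §3.2] -/
theorem sum_pow_mod_eq_sum {β : Type*} [AddCommMonoid β] {j M : ℕ} (hj : 2 ≤ j) (hjM : j ≤ M)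
    {a : ℕ} (ha : ¬p ∣ a) (f : ℕ → β) :
    ∑ k ∈ Finset.range (p ^ (M - j)), f ((1 + p ^ j * a) ^ k % p ^ M) =
      ∑ t ∈ Finset.range (p ^ (M - j)), f (1 + p ^ j * t) := by
  classical
  have hpj : 0 < p ^ j := pow_pos hp.pos j
  have hNM : p ^ j * p ^ (M - j) = p ^ M := by rw [← pow_add]; congr 1; omega
  -- the two index maps
  let e : ℕ → ℕ := fun k => (1 + p ^ j * a) ^ k % p ^ M
  let g : ℕ → ℕ := fun t => 1 + p ^ j * t
  have heinj : Set.InjOn e (Finset.range (p ^ (M - j)) : Set ℕ) := pow_mod_injOn hp hj hjM ha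
  have hginj : Set.InjOn g (Finset.range (p ^ (M - j)) : Set ℕ) := by
    intro t _ t' _ h
    exact Nat.eq_of_mul_eq_mul_left hpj (Nat.add_left_cancel h)
  have hu1 : 1 + p ^ j * a ≡ 1 [MOD p ^ j] :=
    ((Nat.modEq_iff_dvd' (Nat.le_add_right 1 _)).mpr ⟨a, by rw [Nat.add_sub_cancel_left]⟩).symm
  -- every `e k` is some `g t`, `t < N`
  have hsub : (Finset.range (p ^ (M - j))).image e ⊆ (Finset.range (p ^ (M - j))).image g := by
    intro x hx
    obtain ⟨k, -, rfl⟩ := Finset.mem_image.mp hx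
    have h1 : (1 + p ^ j * a) ^ k % p ^ j = 1 % p ^ j := by
      have := hu1.pow k
      rwa [one_pow] at this
    have hlt : e k < p ^ M := Nat.mod_lt _ (pow_pos hp.pos M)
    have h2 : e k % p ^ j = 1 := by
      change ((1 + p ^ j * a) ^ k % p ^ M) % p ^ j = 1
      rw [Nat.mod_mod_of_dvd _ (pow_dvd_pow p hjM), h1]
      exact Nat.mod_eq_of_lt (Nat.one_lt_pow (by omega) hp.one_lt)
    refine Finset.mem_image.mpr ⟨e k / p ^ j, ?_, ?_⟩
    · rw [Finset.mem_range, Nat.div_lt_iff_lt_mul hpj, mul_comm, hNM]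
      exact hlt
    · change 1 + p ^ j * (e k / p ^ j) = e k
      have := Nat.div_add_mod (e k) (p ^ j)
      rw [h2] at this
      omega
  have hcard : ((Finset.range (p ^ (M - j))).image g).card ≤
      ((Finset.range (p ^ (M - j))).image e).card := by
    rw [Finset.card_image_of_injOn hginj, Finset.card_image_of_injOn heinj]
  have heq : (Finset.range (p ^ (M - j))).image e = (Finset.range (p ^ (M - j))).image g :=
    Finset.eq_of_subset_of_card_le hsub hcard
  calc ∑ k ∈ Finset.range (p ^ (M - j)), f (e k)
      = ∑ x ∈ (Finset.range (p ^ (M - j))).image e, f x := (Finset.sum_image heinj).symm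
    _ = ∑ x ∈ (Finset.range (p ^ (M - j))).image g, f x := by rw [heq]
    _ = ∑ t ∈ Finset.range (p ^ (M - j)), f (g t) := Finset.sum_image hginj

end PrincipalUnitPowers

end Literature.NumberTheory.PAdicHodge
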